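import Mathlib.Combinatorics.SimpleGraph.Acyclic
import Mathlib.Combinatorics.SimpleGraph.DeleteEdges
import Mathlib.Data.Nat.Size
import Mathlib.Order.Interval.Finset.Nat
import HarnessLib

/-!
# A spherically symmetric tree percolating at criticality: the combinatorial skeleton

Support file for `Literature/Barriers/CriticalPhenomena/TreesPercolatingAtCriticality.lean`
(the witness behind `TreesPercolatingAtCriticality_holds`, Lyons–Peres 2016, Exercise 5.12 /
Exercise 5.51 (b)): an explicit locally finite, spherically symmetric rooted tree whose level `n`
has exactly
`|T_n| = 2 ^ lvExp n = 2^n · 4^{size n}` vertices (`Nat.size n = ⌊log₂ n⌋ + 1` for `n ≥ 1`), so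
that `n² < |T_n| / 2^n ≤ 4 n²` (`n ≥ 1`): the expected number of level-`n` vertices joined to
the root at `p = 1/2` is `m_n = 4^{size n} ≍ n²`, `Σ_n 1/m_n < ∞`, which is the criterion of
Lyons–Peres 2016, Exercise 5.51 (b) for percolation at `p = 1/2 = 1/br T = p_c` (ibid. (5.6),
Thm. 5.15, Exercise 1.2).

This file is pure combinatorics (no measure theory):

* `CritTree.lvExp n = n + 2 · size n`; the vertex type
  `CritTree.Vert = {x : ℕ × ℕ // x.2 < 2 ^ lvExp x.1}` (level, index within the level);
  `CritTree.mkV n i` (index taken mod `2^{lvExp n}`), `CritTree.root = (0, 0)`;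
* `CritTree.anc k v`, the ancestor of `v` at level `min k (level v)`: the index is divided by
  `2 ^ (lvExp (level v) - lvExp k)` (each level-`k` vertex has `2^{lvExp (k+1) - lvExp k} ∈ {2, 8}`
  children, a contiguous block of indices); `CritTree.parent v = anc (level v - 1) v`;
* `CritTree.tree : SimpleGraph Vert`, adjacency = "one is the parent of the other"; it is a tree
  (`CritTree.tree_isTree`: connected through the ancestors, and every edge `{parent w, w}` is a
  bridge because the descendants of `w` are closed under adjacency avoiding that edge), and
  locally finite (`CritTree.neighborSet_finite`);
* `CritTree.pathEdges v`, the `level v` edges `{anc k v, anc (k+1) v}` of the path from the root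
  (`card_pathEdges`, `pathEdges_subset_edgeSet`, `pathEdges_eq_insert`, `pathEdges_anc_subset`);
* the two counting facts behind the second-moment computation (Lyons–Peres 2016, (5.11)):
  the paths to two level-`n` vertices share at most `M` edges, `M` the deepest level at which
  their ancestors agree (`card_inter_pathEdges_le`, `anc_eq_of_le_findGreatest`), and exactly
  `2 ^ (lvExp n - lvExp k) = |T_n| / |T_k|` level-`n` vertices share the level-`k` ancestor of a
  given one (`card_filter_anc_mkV_eq`, spherical symmetry).

The percolation estimates are in `TreesPercolatingAtCriticalityEstimates.lean`.

## References

* R. Lyons, Y. Peres, *Probability on Trees and Networks*, CUP 2016: §1.2 (spherically symmetric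
  trees, Exercise 1.2), §5.2 (5.6), §5.3 Prop. 5.11 and (5.11), Exercise 5.12 (p. 243),
  Exercise 5.51 (p. 268). [LyonsPeres2016]
-/

namespace Literature.Barriers.CriticalPhenomena

namespace CritTree

/-! ### Level sizes -/

/-- The level-size exponent: level `n` of the tree has `2 ^ lvExp n = 2^n · 4^{Nat.size n}`
vertices (`≍ 2^n n²`), the growth profile of a spherically symmetric tree with `p_c = 1/2`
percolating at criticality. [cite: LyonsPeres2016, Exercise 5.12 and Exercise 5.51 (b)] -/
def lvExp (n : ℕ) : ℕ := n + 2 * n.size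

/-- `lvExp 0 = 0`: the root level has one vertex. [folklore] -/
@[simp] theorem lvExp_zero : lvExp 0 = 0 := by simp [lvExp]

/-- `lvExp` is monotone. [folklore] -/
theorem lvExp_mono : Monotone lvExp := fun _ _ h =>
  Nat.add_le_add h (Nat.mul_le_mul_left 2 (Nat.size_le_size h))

/-- `n ≤ lvExp n`. [folklore] -/
theorem le_lvExp (n : ℕ) : n ≤ lvExp n := Nat.le_add_right _ _

/-- `2 ^ lvExp n = 2 ^ n * 4 ^ size n`. [folklore] -/
theorem two_pow_lvExp (n : ℕ) : 2 ^ lvExp n = 2 ^ n * 4 ^ n.size := by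
  rw [lvExp, pow_add, pow_mul, show (2 : ℕ) ^ 2 = 4 from rfl]

/-! ### Vertices -/

/-- The vertex type: pairs `(level, index)` with `index < 2 ^ lvExp level`.
[cite: LyonsPeres2016, Exercise 5.12 and Exercise 5.51 (b)] -/
abbrev Vert : Type := {x : ℕ × ℕ // x.2 < 2 ^ lvExp x.1}

/-- Two vertices with the same level and index are equal. [folklore] -/
theorem Vert.ext {v w : Vert} (h1 : v.1.1 = w.1.1) (h2 : v.1.2 = w.1.2) : v = w :=
  Subtype.ext (Prod.ext h1 h2)

/-- The vertex of level `n` and index `i mod 2 ^ lvExp n` (a total constructor).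
[cite: LyonsPeres2016, Exercise 5.12 and Exercise 5.51 (b)] -/
def mkV (n i : ℕ) : Vert := ⟨(n, i % 2 ^ lvExp n), Nat.mod_lt _ (Nat.two_pow_pos _)⟩

/-- Level of `mkV n i`. [folklore] -/
@[simp] theorem mkV_level (n i : ℕ) : (mkV n i).1.1 = n := rfl

/-- Index of `mkV n i`. [folklore] -/
@[simp] theorem mkV_index (n i : ℕ) : (mkV n i).1.2 = i % 2 ^ lvExp n := rfl

/-- Index of `mkV n i` for `i` in range. [folklore] -/
theorem mkV_index_of_lt {n i : ℕ} (h : i < 2 ^ lvExp n) : (mkV n i).1.2 = i := Nat.mod_eq_of_lt h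

/-- Every vertex is `mkV` of its level and index. [folklore] -/
theorem mkV_eq (v : Vert) : mkV v.1.1 v.1.2 = v := Vert.ext rfl (Nat.mod_eq_of_lt v.2)

/-- A vertex of level `n` is `mkV n` of its index. [folklore] -/
theorem eq_mkV_of_level {v : Vert} {n : ℕ} (h : v.1.1 = n) : v = mkV n v.1.2 := by
  subst h; exact (mkV_eq v).symm

/-- `mkV n` is injective on `[0, 2 ^ lvExp n)`. [folklore] -/
theorem mkV_injOn (n : ℕ) : Set.InjOn (mkV n) ↑(Finset.range (2 ^ lvExp n)) := by
  intro i hi j hj h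
  have hi' : i < 2 ^ lvExp n := Finset.mem_range.1 hi
  have hj' : j < 2 ^ lvExp n := Finset.mem_range.1 hj
  have h2 : (mkV n i).1.2 = (mkV n j).1.2 := by rw [h]
  rwa [mkV_index_of_lt hi', mkV_index_of_lt hj'] at h2

/-- The root `(0, 0)`. [cite: LyonsPeres2016, Exercise 5.12 and Exercise 5.51 (b)] -/
def root : Vert := mkV 0 0

/-- The root has level `0`. [folklore] -/
@[simp] theorem root_level : root.1.1 = 0 := rfl

/-- The root is the only vertex of level `0`. [folklore] -/
theorem eq_root_of_level {v : Vert} (h : v.1.1 = 0) : v = root := by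
  refine Vert.ext h ?_
  have hv : v.1.2 < 2 ^ lvExp v.1.1 := v.2
  rw [h, lvExp_zero, pow_zero] at hv
  show v.1.2 = 0 % 2 ^ lvExp 0
  simp only [lvExp_zero, pow_zero, Nat.zero_mod]
  omega

/-- A vertex other than the root has positive level. [folklore] -/
theorem level_pos_of_ne_root {v : Vert} (hv : v ≠ root) : 0 < v.1.1 :=
  Nat.pos_of_ne_zero fun h => hv (eq_root_of_level h)

/-! ### Ancestors and the parent -/

/-- The ancestor of `v` at level `min k (level v)`: its index is the index of `v` divided by
`2 ^ (lvExp (level v) - lvExp k)` (spherical symmetry: consecutive blocks of indices are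
siblings). [cite: LyonsPeres2016, Exercise 5.12 and Exercise 5.51 (b)] -/
def anc (k : ℕ) (v : Vert) : Vert :=
  ⟨(min k v.1.1, v.1.2 / 2 ^ (lvExp v.1.1 - lvExp (min k v.1.1))), by
    show v.1.2 / 2 ^ (lvExp v.1.1 - lvExp (min k v.1.1)) < 2 ^ lvExp (min k v.1.1)
    rw [Nat.div_lt_iff_lt_mul (Nat.two_pow_pos _), ← pow_add,
      Nat.add_sub_cancel' (lvExp_mono (min_le_right k v.1.1))]
    exact v.2⟩

/-- Level of an ancestor. [folklore] -/
@[simp] theorem anc_level (k : ℕ) (v : Vert) : (anc k v).1.1 = min k v.1.1 := rfl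

/-- Index of an ancestor. [folklore] -/
theorem anc_index (k : ℕ) (v : Vert) :
    (anc k v).1.2 = v.1.2 / 2 ^ (lvExp v.1.1 - lvExp (min k v.1.1)) := rfl

/-- Level of a genuine ancestor. [folklore] -/
theorem anc_level_of_le {k : ℕ} {v : Vert} (h : k ≤ v.1.1) : (anc k v).1.1 = k := min_eq_left h

/-- Index of a genuine ancestor. [folklore] -/
theorem anc_index_of_le {k : ℕ} {v : Vert} (h : k ≤ v.1.1) :
    (anc k v).1.2 = v.1.2 / 2 ^ (lvExp v.1.1 - lvExp k) := by
  rw [anc_index, min_eq_left h]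

/-- Above its own level a vertex is its own ancestor. [folklore] -/
theorem anc_of_le {k : ℕ} {v : Vert} (h : v.1.1 ≤ k) : anc k v = v :=
  Vert.ext (by simp [h]) (by rw [anc_index, min_eq_right h, Nat.sub_self, pow_zero, Nat.div_one])

/-- `anc (level v) v = v`. [folklore] -/
@[simp] theorem anc_self (v : Vert) : anc v.1.1 v = v := anc_of_le le_rfl

/-- The level-`0` ancestor is the root. [folklore] -/
@[simp] theorem anc_zero (v : Vert) : anc 0 v = root := eq_root_of_level (by simp)

/-- Ancestors compose: the level-`j` ancestor of the level-`k` ancestor (`j ≤ k`) is the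
level-`j` ancestor. [folklore] -/
theorem anc_anc {j k : ℕ} (h : j ≤ k) (v : Vert) : anc j (anc k v) = anc j v := by
  rcases le_total k v.1.1 with hk | hk
  · have hjk : j ≤ (anc k v).1.1 := by rwa [anc_level_of_le hk]
    refine Vert.ext ?_ ?_
    · rw [anc_level_of_le hjk, anc_level_of_le (h.trans hk)]
    · rw [anc_index_of_le hjk, anc_index_of_le hk, anc_index_of_le (h.trans hk),
        anc_level_of_le hk, Nat.div_div_eq_div_mul, ← pow_add,
        Nat.sub_add_sub_cancel (lvExp_mono hk) (lvExp_mono h)]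
  · rw [anc_of_le hk]

/-- Ancestors of `mkV n i`: divide the index. [folklore] -/
theorem anc_mkV {k n i : ℕ} (hk : k ≤ n) (hi : i < 2 ^ lvExp n) :
    anc k (mkV n i) = mkV k (i / 2 ^ (lvExp n - lvExp k)) := by
  have hlt : i / 2 ^ (lvExp n - lvExp k) < 2 ^ lvExp k := by
    rw [Nat.div_lt_iff_lt_mul (Nat.two_pow_pos _), ← pow_add, Nat.add_sub_cancel' (lvExp_mono hk)]
    exact hi
  refine Vert.ext ?_ ?_
  · rw [anc_level_of_le (show k ≤ (mkV n i).1.1 from hk), mkV_level]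
  · rw [anc_index_of_le (show k ≤ (mkV n i).1.1 from hk), mkV_level, mkV_index_of_lt hi,
      mkV_index_of_lt hlt]

/-- Two level-`n` vertices have the same level-`k` ancestor iff their indices agree after
division by `2 ^ (lvExp n - lvExp k)`. [folklore] -/
theorem anc_mkV_eq_anc_mkV_iff {k n i j : ℕ} (hk : k ≤ n) (hi : i < 2 ^ lvExp n)
    (hj : j < 2 ^ lvExp n) :
    anc k (mkV n i) = anc k (mkV n j) ↔
      i / 2 ^ (lvExp n - lvExp k) = j / 2 ^ (lvExp n - lvExp k) := by
  have hlt : ∀ {m : ℕ}, m < 2 ^ lvExp n → m / 2 ^ (lvExp n - lvExp k) < 2 ^ lvExp k := by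
    intro m hm
    rw [Nat.div_lt_iff_lt_mul (Nat.two_pow_pos _), ← pow_add, Nat.add_sub_cancel' (lvExp_mono hk)]
    exact hm
  rw [anc_mkV hk hi, anc_mkV hk hj]
  constructor
  · intro h
    exact mkV_injOn k (Finset.mem_range.2 (hlt hi)) (Finset.mem_range.2 (hlt hj)) h
  · intro h
    rw [h]

/-- The parent of `v` (the root is its own parent).
[cite: LyonsPeres2016, Exercise 5.12 and Exercise 5.51 (b)] -/
def parent (v : Vert) : Vert := anc (v.1.1 - 1) v

/-- Level of the parent. [folklore] -/
@[simp] theorem parent_level (v : Vert) : (parent v).1.1 = v.1.1 - 1 :=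
  min_eq_left (Nat.sub_le _ _)

/-- The root is its own parent. [folklore] -/
@[simp] theorem parent_root : parent root = root := anc_zero root

/-- The parent of a level-`(n+1)` vertex is its level-`n` ancestor. [folklore] -/
theorem parent_eq_anc {v : Vert} {n : ℕ} (hv : v.1.1 = n + 1) : parent v = anc n v := by
  rw [parent, hv, Nat.add_sub_cancel]

/-- Ancestors of the parent are ancestors. [folklore] -/
theorem anc_parent {k : ℕ} {v : Vert} (h : k + 1 ≤ v.1.1) : anc k (parent v) = anc k v :=
  anc_anc (by omega) v

/-- The parent of the level-`(k+1)` ancestor is the level-`k` ancestor. [folklore] -/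
theorem parent_anc_succ {k : ℕ} {v : Vert} (h : k < v.1.1) : parent (anc (k + 1) v) = anc k v := by
  rw [parent_eq_anc (anc_level_of_le (Nat.succ_le_of_lt h)), anc_anc (Nat.le_succ k)]

/-- A vertex other than the root differs from its parent. [folklore] -/
theorem parent_ne {v : Vert} (hv : v ≠ root) : parent v ≠ v := by
  intro h
  have h1 := congrArg (fun u : Vert => u.1.1) h
  simp only [parent_level] at h1
  have := level_pos_of_ne_root hv
  omega

/-! ### The tree -/

/-- The tree: `x ∼ y` iff one of them is the parent of the other (and `x ≠ y`).
[cite: LyonsPeres2016, Exercise 5.12 and Exercise 5.51 (b)] -/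
def tree : SimpleGraph Vert := SimpleGraph.fromRel fun x y => parent y = x

/-- Adjacency in the tree. [folklore] -/
theorem tree_adj {x y : Vert} :
    tree.Adj x y ↔ (parent y = x ∧ y ≠ root) ∨ (parent x = y ∧ x ≠ root) := by
  rw [tree, SimpleGraph.fromRel_adj]
  constructor
  · rintro ⟨hne, h | h⟩
    · refine Or.inl ⟨h, fun hy => hne ?_⟩
      rw [hy] at h ⊢
      rw [parent_root] at h
      exact h.symm
    · refine Or.inr ⟨h, fun hx => hne ?_⟩
      rw [hx] at h ⊢
      rw [parent_root] at h
      exact h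
  · rintro (⟨h, hy⟩ | ⟨h, hx⟩)
    · exact ⟨fun hxy => parent_ne hy (h.trans hxy), Or.inl h⟩
    · exact ⟨fun hxy => parent_ne hx (h.trans hxy.symm), Or.inr h⟩

/-- Every vertex other than the root is adjacent to its parent. [folklore] -/
theorem parent_adj {y : Vert} (hy : y ≠ root) : tree.Adj (parent y) y :=
  tree_adj.2 (Or.inl ⟨rfl, hy⟩)

/-- Consecutive ancestors are adjacent. [folklore] -/
theorem adj_anc_succ {k : ℕ} {v : Vert} (h : k < v.1.1) : tree.Adj (anc k v) (anc (k + 1) v) := by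
  have hne : anc (k + 1) v ≠ root := fun h0 => by
    have := congrArg (fun u : Vert => u.1.1) h0
    simp only [anc_level_of_le (Nat.succ_le_of_lt h), root_level] at this
    omega
  have := parent_adj hne
  rwa [parent_anc_succ h] at this

/-- Neighbours have level at most one more. [folklore] -/
theorem level_lt_of_adj {x y : Vert} (h : tree.Adj x y) : y.1.1 < x.1.1 + 2 := by
  rcases tree_adj.1 h with ⟨hp, -⟩ | ⟨hp, -⟩
  · have := parent_level y
    rw [hp] at this
    omega
  · have := parent_level x
    rw [hp] at this
    omega

/-- Every vertex is joined to the root (through its ancestors). [folklore] -/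
theorem reachable_root (v : Vert) : tree.Reachable root v := by
  suffices h : ∀ n : ℕ, ∀ v : Vert, v.1.1 = n → tree.Reachable root v from h _ v rfl
  intro n
  induction n with
  | zero => intro v hv; rw [eq_root_of_level hv]
  | succ n ih =>
    intro v hv
    have hv0 : v ≠ root := fun h => by rw [h, root_level] at hv; exact Nat.succ_ne_zero n hv.symm
    exact (ih (parent v) (by rw [parent_level, hv, Nat.add_sub_cancel])).trans
      (parent_adj hv0).reachable

/-- The tree is connected. [folklore] -/
theorem tree_connected : tree.Connected :=
  (SimpleGraph.connected_iff _).2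
    ⟨fun u v => (reachable_root u).symm.trans (reachable_root v), ⟨root⟩⟩

/-- **Every edge is a bridge**: removing `{parent w, w}` disconnects `w` from its parent, since
the set of descendants of `w` is closed under the remaining adjacency. [folklore] -/
theorem isBridge_parent {w : Vert} (hw : w ≠ root) : tree.IsBridge s(parent w, w) := by
  rw [SimpleGraph.isBridge_iff]
  set D : Set Vert := {x | w.1.1 ≤ x.1.1 ∧ anc w.1.1 x = w} with hD
  have hclosed : ∀ x y : Vert, x ∈ D → (tree.deleteEdges {s(parent w, w)}).Adj x y → y ∈ D := by
    intro x y hx hxy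
    rw [SimpleGraph.deleteEdges_adj, Set.mem_singleton_iff] at hxy
    obtain ⟨hadj, hne⟩ := hxy
    obtain ⟨hxl, hxa⟩ := hx
    rcases tree_adj.1 hadj with ⟨hp, hy⟩ | ⟨hp, hx0⟩
    · -- `y` is a child of `x`
      have hyl : y.1.1 = x.1.1 + 1 := by
        have h1 := parent_level y
        rw [hp] at h1
        have := level_pos_of_ne_root hy
        omega
      refine ⟨by omega, ?_⟩
      rw [← anc_parent (show w.1.1 + 1 ≤ y.1.1 by omega), hp]
      exact hxa
    · -- `y` is the parent of `x`
      by_cases hxw : x = w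
      · refine absurd ?_ hne
        rw [hxw, ← hp, hxw, Sym2.eq_swap]
      · have hlt : w.1.1 < x.1.1 := by
          by_contra hge
          apply hxw
          have heq : w.1.1 = x.1.1 := le_antisymm hxl (not_lt.1 hge)
          have := hxa
          rw [heq, anc_self] at this
          exact this
        refine ⟨by rw [← hp, parent_level]; omega, ?_⟩
        rw [← hp, anc_parent (show w.1.1 + 1 ≤ x.1.1 by omega)]
        exact hxa
  have hstay : ∀ x y : Vert, (tree.deleteEdges {s(parent w, w)}).Reachable x y → x ∈ D → y ∈ D := by
    rintro x y ⟨p⟩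
    induction p with
    | nil => exact id
    | cons h _ ih => exact fun hx => ih (hclosed _ _ hx h)
  intro hreach
  have hmem : parent w ∈ D := hstay w (parent w) hreach.symm ⟨le_rfl, anc_self w⟩
  have h1 := hmem.1
  rw [parent_level] at h1
  have := level_pos_of_ne_root hw
  omega

/-- The tree is acyclic. [folklore] -/
theorem tree_isAcyclic : tree.IsAcyclic := by
  rw [SimpleGraph.isAcyclic_iff_forall_adj_isBridge]
  intro v w h
  rcases tree_adj.1 h with ⟨hp, hw⟩ | ⟨hp, hv⟩
  · rw [← hp]; exact isBridge_parent hw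
  · rw [← hp, Sym2.eq_swap]; exact isBridge_parent hv

/-- **The graph is a tree.** [cite: LyonsPeres2016, Exercise 5.12 and Exercise 5.51 (b)] -/
theorem tree_isTree : tree.IsTree := ⟨tree_connected, tree_isAcyclic⟩

/-! ### Finiteness of levels and local finiteness -/

/-- There are finitely many vertices below any level. [folklore] -/
theorem finite_setOf_level_lt (n : ℕ) : {v : Vert | v.1.1 < n}.Finite := by
  have hfin : (↑(Finset.range n ×ˢ Finset.range (2 ^ lvExp n)) : Set (ℕ × ℕ)).Finite :=
    Finset.finite_toSet _
  refine (hfin.preimage Subtype.val_injective.injOn).subset ?_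
  intro v hv
  have hv : v.1.1 < n := hv
  simp only [Set.mem_preimage, Finset.coe_product, Finset.coe_range, Set.mem_prod, Set.mem_Iio]
  exact ⟨hv, v.2.trans_le (Nat.pow_le_pow_right Nat.two_pos (lvExp_mono hv.le))⟩

/-- **The tree is locally finite.** [cite: LyonsPeres2016, Exercise 5.12 and Exercise 5.51 (b)] -/
theorem neighborSet_finite (x : Vert) : (tree.neighborSet x).Finite :=
  (finite_setOf_level_lt (x.1.1 + 2)).subset fun _ hy => level_lt_of_adj hy

/-! ### The edges of the path from the root -/

/-- The edges `{anc k v, anc (k+1) v}`, `k < level v`, of the path from the root to `v`.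
[cite: LyonsPeres2016, §5.2 (proof of (5.6))] -/
def pathEdges (v : Vert) : Finset (Sym2 Vert) :=
  (Finset.range v.1.1).image fun k => s(anc k v, anc (k + 1) v)

/-- Membership in `pathEdges`. [folklore] -/
theorem mem_pathEdges {v : Vert} {e : Sym2 Vert} :
    e ∈ pathEdges v ↔ ∃ k < v.1.1, s(anc k v, anc (k + 1) v) = e := by
  simp [pathEdges, Finset.mem_image, Finset.mem_range]

/-- The root has no path edges. [folklore] -/
@[simp] theorem pathEdges_root : pathEdges root = ∅ := by
  simp [pathEdges]

/-- Path edges are edges of the tree. [folklore] -/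
theorem pathEdges_subset_edgeSet (v : Vert) : (↑(pathEdges v) : Set (Sym2 Vert)) ⊆ tree.edgeSet := by
  intro e he
  obtain ⟨k, hk, rfl⟩ := mem_pathEdges.1 (Finset.mem_coe.1 he)
  exact (SimpleGraph.mem_edgeSet _).2 (adj_anc_succ hk)

/-- **The path from the root to `v` has `level v` edges.** [cite: LyonsPeres2016, §5.2 (proof of (5.6))] -/
theorem card_pathEdges (v : Vert) : (pathEdges v).card = v.1.1 := by
  rw [pathEdges, Finset.card_image_of_injOn, Finset.card_range]
  intro j hj k hk hjk
  have hj' : j < v.1.1 := Finset.mem_range.1 hj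
  have hk' : k < v.1.1 := Finset.mem_range.1 hk
  have hjl : (anc j v).1.1 = j := anc_level_of_le hj'.le
  have hkl : (anc k v).1.1 = k := anc_level_of_le hk'.le
  have hjl' : (anc (j + 1) v).1.1 = j + 1 := anc_level_of_le (Nat.succ_le_of_lt hj')
  have hkl' : (anc (k + 1) v).1.1 = k + 1 := anc_level_of_le (Nat.succ_le_of_lt hk')
  rcases Sym2.eq_iff.1 hjk with ⟨h1, -⟩ | ⟨h1, h2⟩
  · have e1 : (anc j v).1.1 = (anc k v).1.1 := by rw [h1]
    rwa [hjl, hkl] at e1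
  · have e1 : (anc j v).1.1 = (anc (k + 1) v).1.1 := by rw [h1]
    have e2 : (anc (j + 1) v).1.1 = (anc k v).1.1 := by rw [h2]
    rw [hjl, hkl'] at e1
    rw [hjl', hkl] at e2
    omega

/-- The path to an ancestor is an initial segment of the path. [folklore] -/
theorem pathEdges_anc_subset (k : ℕ) (v : Vert) : pathEdges (anc k v) ⊆ pathEdges v := by
  intro e he
  obtain ⟨j, hj, rfl⟩ := mem_pathEdges.1 he
  rw [anc_level] at hj
  obtain ⟨hjk, hjn⟩ := lt_min_iff.1 hj
  rw [anc_anc hjk.le, anc_anc (Nat.succ_le_of_lt hjk)]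
  exact mem_pathEdges.2 ⟨j, hjn, rfl⟩

/-- The path to the parent is an initial segment of the path. [folklore] -/
theorem pathEdges_parent_subset (v : Vert) : pathEdges (parent v) ⊆ pathEdges v :=
  pathEdges_anc_subset _ v

/-- **The path to a level-`(n+1)` vertex is the path to its parent plus the last edge.**
[folklore] -/
theorem pathEdges_eq_insert {v : Vert} {n : ℕ} (hv : v.1.1 = n + 1) :
    pathEdges v = insert s(parent v, v) (pathEdges (parent v)) := by
  rw [parent_eq_anc hv]
  have hn : n ≤ v.1.1 := by omega
  have hlast : s(anc n v, anc (n + 1) v) = s(anc n v, v) := by rw [← hv, anc_self]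
  have hcongr : Set.EqOn (fun k => s(anc k v, anc (k + 1) v))
      (fun k => s(anc k (anc n v), anc (k + 1) (anc n v))) ↑(Finset.range n) := by
    intro k hk
    have hk : k < n := Finset.mem_range.1 hk
    simp only [anc_anc hk.le, anc_anc (Nat.succ_le_of_lt hk)]
  unfold pathEdges
  rw [anc_level_of_le hn, hv, Finset.range_add_one, Finset.image_insert, Finset.image_congr hcongr]
  congr 1

/-- The last edge of the path to a level-`(n+1)` vertex. [folklore] -/
theorem mem_pathEdges_parent {v : Vert} {n : ℕ} (hv : v.1.1 = n + 1) :
    s(parent v, v) ∈ pathEdges v := by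
  rw [pathEdges_eq_insert hv]
  exact Finset.mem_insert_self _ _

/-! ### The meet of two level-`n` vertices -/

/-- Below the deepest level `M` at which the ancestors of `v` and `w` agree, all their ancestors
agree. [folklore] -/
theorem anc_eq_of_le_findGreatest {v w : Vert} {k : ℕ}
    (hk : k ≤ Nat.findGreatest (fun k => anc k v = anc k w) v.1.1) : anc k v = anc k w := by
  have hspec : anc (Nat.findGreatest (fun k => anc k v = anc k w) v.1.1) v =
      anc (Nat.findGreatest (fun k => anc k v = anc k w) v.1.1) w :=
    Nat.findGreatest_spec (P := fun k => anc k v = anc k w) (Nat.zero_le _) (by simp)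
  rw [← anc_anc hk v, hspec, anc_anc hk]

/-- **The paths to two vertices share at most `M` edges**, `M` the deepest level (up to the
level of the first) at which their ancestors agree (Lyons–Peres 2016, (5.11): `P[o ↔ x, o ↔ y] =
P[o ↔ x] P[o ↔ y] / P[o ↔ x ∧ y]`). [cite: LyonsPeres2016, §5.3 (5.11)] -/
theorem card_inter_pathEdges_le (v w : Vert) :
    (pathEdges v ∩ pathEdges w).card ≤ Nat.findGreatest (fun k => anc k v = anc k w) v.1.1 := by
  set M := Nat.findGreatest (fun k => anc k v = anc k w) v.1.1 with hM
  calc (pathEdges v ∩ pathEdges w).card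
      ≤ ((Finset.range M).image fun k => s(anc k v, anc (k + 1) v)).card := by
        refine Finset.card_le_card fun e he => ?_
        rw [Finset.mem_inter] at he
        obtain ⟨k, hk, rfl⟩ := mem_pathEdges.1 he.1
        obtain ⟨j, hj, hjk⟩ := mem_pathEdges.1 he.2
        have hjl : (anc j w).1.1 = j := anc_level_of_le hj.le
        have hkl : (anc k v).1.1 = k := anc_level_of_le hk.le
        have hjl' : (anc (j + 1) w).1.1 = j + 1 := anc_level_of_le (Nat.succ_le_of_lt hj)
        have hkl' : (anc (k + 1) v).1.1 = k + 1 := anc_level_of_le (Nat.succ_le_of_lt hk)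
        have hkM : k + 1 ≤ M := by
          rcases Sym2.eq_iff.1 hjk with ⟨h1, h2⟩ | ⟨h1, h2⟩
          · have e1 : (anc j w).1.1 = (anc k v).1.1 := by rw [h1]
            rw [hjl, hkl] at e1
            subst e1
            exact Nat.le_findGreatest (P := fun k => anc k v = anc k w)
              (Nat.succ_le_of_lt hk) h2.symm
          · have e1 : (anc j w).1.1 = (anc (k + 1) v).1.1 := by rw [h1]
            have e2 : (anc (j + 1) w).1.1 = (anc k v).1.1 := by rw [h2]
            rw [hjl, hkl'] at e1
            rw [hjl', hkl] at e2
            omega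
        exact Finset.mem_image.2 ⟨k, Finset.mem_range.2 (by omega), rfl⟩
    _ ≤ (Finset.range M).card := Finset.card_image_le
    _ = M := Finset.card_range M

/-! ### Spherical symmetry: counting vertices below an ancestor -/

/-- **Exactly `2 ^ (lvExp n - lvExp k) = |T_n| / |T_k|` level-`n` vertices share the level-`k`
ancestor of a given level-`n` vertex** (`k ≤ n`). [cite: LyonsPeres2016, §1.2 (spherically symmetric trees)] -/
theorem card_filter_anc_mkV_eq {n k i : ℕ} (hk : k ≤ n) (hi : i < 2 ^ lvExp n) :
    ((Finset.range (2 ^ lvExp n)).filter fun j => anc k (mkV n i) = anc k (mkV n j)).card =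
      2 ^ (lvExp n - lvExp k) := by
  set D := 2 ^ (lvExp n - lvExp k) with hD
  have hDpos : 0 < D := Nat.two_pow_pos _
  have hDN : 2 ^ lvExp k * D = 2 ^ lvExp n := by
    rw [hD, ← pow_add, Nat.add_sub_cancel' (lvExp_mono hk)]
  set q := i / D with hq
  have hqlt : q < 2 ^ lvExp k := by
    rw [hq, Nat.div_lt_iff_lt_mul hDpos, hDN]
    exact hi
  set a := q * D with ha
  have haD : a + D ≤ 2 ^ lvExp n := by
    rw [← hDN, ha, ← Nat.succ_mul]
    exact Nat.mul_le_mul_right D hqlt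
  have hfilter : ((Finset.range (2 ^ lvExp n)).filter fun j => anc k (mkV n i) = anc k (mkV n j)) =
      Finset.Ico a (a + D) := by
    ext j
    simp only [Finset.mem_filter, Finset.mem_range, Finset.mem_Ico]
    constructor
    · rintro ⟨hj, hij⟩
      rw [anc_mkV_eq_anc_mkV_iff hk hi hj] at hij
      have h2 := (Nat.div_eq_iff hDpos).1 hij.symm
      rw [← ha] at h2
      omega
    · rintro ⟨h1, h2⟩
      have hj : j < 2 ^ lvExp n := lt_of_lt_of_le h2 haD
      refine ⟨hj, ?_⟩
      rw [anc_mkV_eq_anc_mkV_iff hk hi hj]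
      symm
      rw [Nat.div_eq_iff hDpos, ← ha]
      omega
  rw [hfilter, Nat.card_Ico]
  omega

/-! ### The path events (sets of bond configurations; no measure theory here) -/

/-- The event "every edge of the path from the root to `v` is open", as a set of bond
configurations `ω ⊆ Sym2 Vert` (the set of open edges). [cite: LyonsPeres2016, §5.2 (proof of (5.6))] -/
def pathOpen (v : Vert) : Set (Set (Sym2 Vert)) := {ω | ↑(pathEdges v) ⊆ ω}

/-- Membership in `pathOpen`. [folklore] -/
theorem mem_pathOpen {v : Vert} {ω : Set (Sym2 Vert)} : ω ∈ pathOpen v ↔ ↑(pathEdges v) ⊆ ω :=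
  Iff.rfl

/-- The path to the root is empty, so `pathOpen root` is everything. [folklore] -/
@[simp] theorem pathOpen_root : pathOpen root = Set.univ := by
  ext ω; simp [pathOpen]

/-- `pathOpen` is monotone along ancestors: an open path to `v` contains an open path to each
ancestor. [folklore] -/
theorem pathOpen_subset_pathOpen_anc (k : ℕ) (v : Vert) : pathOpen v ⊆ pathOpen (anc k v) :=
  fun _ hω => Set.Subset.trans (Finset.coe_subset.2 (pathEdges_anc_subset k v)) hω

/-- The event "some vertex of level `n` is joined to the root by an open path of the tree"
(`o ↔ T_n` along tree paths), as a finite union over the level.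
[cite: LyonsPeres2016, §5.3 (o ↔ Π for the level cutset)] -/
def levelOpen (n : ℕ) : Set (Set (Sym2 Vert)) := ⋃ i ∈ Finset.range (2 ^ lvExp n), pathOpen (mkV n i)

/-- Membership in `levelOpen`, indexed form. [folklore] -/
theorem mem_levelOpen {n : ℕ} {ω : Set (Sym2 Vert)} :
    ω ∈ levelOpen n ↔ ∃ i < 2 ^ lvExp n, ω ∈ pathOpen (mkV n i) := by
  simp only [levelOpen, Set.mem_iUnion, Finset.mem_range, exists_prop]

/-- Membership in `levelOpen`, vertex form. [folklore] -/
theorem mem_levelOpen_iff {n : ℕ} {ω : Set (Sym2 Vert)} :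
    ω ∈ levelOpen n ↔ ∃ v : Vert, v.1.1 = n ∧ ↑(pathEdges v) ⊆ ω := by
  rw [mem_levelOpen]
  constructor
  · rintro ⟨i, -, hi⟩
    exact ⟨mkV n i, rfl, hi⟩
  · rintro ⟨v, hv, hω⟩
    refine ⟨v.1.2, hv ▸ v.2, ?_⟩
    rw [← eq_mkV_of_level hv]
    exact hω

/-- The level events decrease: an open path to level `n + 1` passes through level `n`.
[cite: LyonsPeres2016, §5.3 (5.9)] -/
theorem levelOpen_succ_subset (n : ℕ) : levelOpen (n + 1) ⊆ levelOpen n := by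
  intro ω hω
  obtain ⟨v, hv, hω⟩ := mem_levelOpen_iff.1 hω
  refine mem_levelOpen_iff.2 ⟨parent v, by rw [parent_level, hv, Nat.add_sub_cancel], ?_⟩
  exact Set.Subset.trans (Finset.coe_subset.2 (pathEdges_parent_subset v)) hω

/-- `levelOpen` is antitone. [cite: LyonsPeres2016, §5.3 (5.9)] -/
theorem levelOpen_antitone : Antitone levelOpen := antitone_nat_of_succ_le levelOpen_succ_subset

/-- The root belongs to level `0`, so `levelOpen 0` is everything. [folklore] -/
@[simp] theorem levelOpen_zero : levelOpen 0 = Set.univ := by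
  refine Set.eq_univ_of_forall fun ω => mem_levelOpen_iff.2 ⟨root, rfl, ?_⟩
  simp

end CritTree

end Literature.Barriers.CriticalPhenomena
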